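import Summits.ResolutionOfSingularities.ResolutionOfSingularities.Theorems.HilbertSamuelEliminationSigmaMaxModificationsCorridor3WLadderE1Tower
import Summits.ResolutionOfSingularities.ResolutionOfSingularities.Theorems.HilbertSamuelEliminationSigmaMaxModificationsCorridor3WLadderIsoTailExtraction
import Summits.ResolutionOfSingularities.ResolutionOfSingularities.Theorems.HilbertSamuelEliminationSigmaMaxModificationsCorridor3WLadderIsoLowFreeBridge
import HarnessLib

/-!
# [OURS · L1 W4.2] The `e = 1` door through the arc — **THE MOVING-CHAIN SOCKET IN THE HYPERSURFACE CELL**: an `e = 1`, `ē ≤ 2` moving chain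
# whose stages are isolated in the Hilbert–Samuel locus, out of a stage with a hypersurface presentation, does not exist — modulo the
# (F1♯) doors only (crux `SigmaMaxModifications` stmt-ResolutionOfSingularities-18506 / conjunct stmt-…-19249, line `w_ladder`, row
# `stub_Wlow3M_two` (β); `--supports 19249`, helper)

Stub worker res-L1-w42-stub-3 (gen 5). Sorry-free PROOF file, no definition, no named fact. OURS bookkeeping for the W4.2 crux chain
(cell res-hironaka); NOT a statement of [Hironaka2017] nor of [CossartJannsenSaito2020]. AI-written; AI review is weaker than expert review.

* `E1Free.exists_isoStageTower_of_movingChain'` — res-D-pv-042's stage-tower extraction (`Moving.exists_isoStageTower_of_movingChain`,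
  `…Corridor3WLadderIsoTailTower`) with ONE extra export: no stage before the first genuine stage `g 0` is blown up (so the stalk at the
  chain's start is the stalk at the tower's base). Proof copied verbatim, plus that line.
* **`E1Free.false_of_e1MovingChain_of_hypersurfaceStage`** — from a stage `c 0` reached from a maximal origin (characteristic `p`, level
  `3`) with `e = 1`, `ē ≤ 2` and a HYPERSURFACE presentation of `𝒪_{X_0,x_0}` (`R` regular local, `CharP R p`, `emb.dim 4`, `ker σ = (h)`,
  `h ∈ 𝔪^m ∖ 𝔪^{m+1}`, `m ≥ 2`): a MOVING chain of canonical near steps out of it, all of whose stages are ISOLATED in the Hilbert–Samuel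
  locus, is impossible — GIVEN ONLY the (F1♯) doors `Theorem314_geomDir`, `Thm314_point_locus_geomDir` (both ⟸ F-51′ `Hironaka1970_thmIV`,
  stub-3 g4) and CJS Thm. 3.10 (4). Route: `e ≤ 1`/`ē ≤ 2` persist (stub-2), `e = 1` at genuine stages (stub-3), the stage tower (042),
  points on `ℙ(Dir)` by the door, and `false_of_e1PointTower_of_hypersurfaceStage` (p544245). This is the `e = 1` third door
  `IsoLowDirDimTerminatesFreeM` WITHOUT `Corollary637_geomDir`, in the hypersurface cell, for chains isolated throughout (the W-low
  units/`Iso` rows; isolation persistence along `e = 1` chains from an isolated start is the one remaining lemma for the full door).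

[OURS · L1 W4.2; AI-written] [cite: CossartJannsenSaito2020, Def. 6.34, Cor. 6.37, Thm. 3.14, Thm. 3.10 (4), p. 107] [cite: CossartPiltant2009, ch. 3 I.9]
-/

set_option linter.dupNamespace false

noncomputable section

open CategoryTheory CategoryTheory.Limits AlgebraicGeometry TopologicalSpace IsLocalRing MvPolynomial Module
open Literature.RingTheory.MvPolynomial Literature.RingTheory.HilbertSamuel Literature.AlgebraicGeometry.Resolution
open Literature.AlgebraicGeometry.CossartJannsenSaito2020
open Scheme.IdealSheafData
open Summit.ResolutionOfSingularities.ResolutionOfSingularities.Theorems.CampaignW42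
open Summit.ResolutionOfSingularities.ResolutionOfSingularities.Theorems.SigmaMaxModificationsCorridor3
open Summit.ResolutionOfSingularities.ResolutionOfSingularities.Theorems.SigmaMaxModificationsCorridor3.Helpers
open Summit.ResolutionOfSingularities.ResolutionOfSingularities.Theorems.SigmaMaxModificationsCorridor3.Moving
open Summit.ResolutionOfSingularities.ResolutionOfSingularities.Cruxes.SigmaMaxModifications.IdeasL1C5
open Summit.ResolutionOfSingularities.ResolutionOfSingularities.Cruxes.SigmaMaxModifications.IdeasL1C4
open Summit.ResolutionOfSingularities.ResolutionOfSingularities.Cruxes.SigmaMaxModifications.IdeasL1Idea2R4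

namespace Summit.ResolutionOfSingularities.ResolutionOfSingularities.Theorems.SigmaMaxModificationsCorridor3.E1Free

universe u

variable {R : ∀ S : Scheme.{u}, CentreSeq S → Prop} {N : ℕ} {ν : ℕ → ℕ}

/-- **res-D-pv-042's stage tower of a moving chain with isolated blown-up points, with the waiting prefix exported**: as
`Moving.exists_isoStageTower_of_movingChain`, plus «no stage `< g 0` is blown up» (the start of the chain and the base of the tower have
isomorphic local rings). Proof = 042's, verbatim. [cite: CossartJannsenSaito2020, p. 107, Def. 6.34, Def. 6.38, Rem. 6.29 (1)] -/
theorem exists_isoStageTower_of_movingChain' (hRf : OracleFunctional R) (hRa : OracleAdmissible R) {p : ℕ}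
    {X : Scheme.{u}} [IsLocallyNoetherian X] {x : X} (hX : IsMaximalOrigin p N ν X x) (hν : ν ≠ iterPSum N Phi)
    {c : ℕ → MarkedStage.{u}} (h0 : Reaches R N ν (MarkedStage.init X x) (c 0))
    (hstep : ∀ n, CanonicalNearStep R N ν (c n) (c (n + 1))) (hmov : ∀ n, ∃ m, n ≤ m ∧ (c m).IsBlownUp R N ν)
    (hI : ∀ n, (c n).IsBlownUp R N ν → Iso N (c n)) :
    ∃ (g : ℕ → ℕ) (T : BlowupTower.{u}) (y : ∀ j, T.X j),
      StrictMono g ∧ (∀ j, (c (g j)).IsBlownUp R N ν) ∧ (∀ m, m < g 0 → ¬ (c m).IsBlownUp R N ν) ∧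
      (∀ j, T.C j = {y j}) ∧ (∀ j, IsClosed ({y j} : Set (T.X j))) ∧ (∀ j, (T.π j).base (y (j + 1)) = y j) ∧
      (∀ j, Nonempty ((T.X j).presheaf.stalk (y j) ≅ (c (g j)).W.presheaf.stalk (c (g j)).pt)) ∧
      (∀ P : ∀ Y : Scheme.{u}, Y → Prop, P (c (g 0)).W (c (g 0)).pt → P (T.X 0) (y 0)) := by
  classical
  let next : ℕ → ℕ := fun n => Nat.find (hmov n)
  have next_spec : ∀ n, n ≤ next n ∧ (c (next n)).IsBlownUp R N ν := fun n => Nat.find_spec (hmov n)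
  have next_min : ∀ n m, n ≤ m → (c m).IsBlownUp R N ν → next n ≤ m :=
    fun n m hnm hb => Nat.find_min' (hmov n) ⟨hnm, hb⟩
  have next_wait : ∀ n m, n ≤ m → m < next n → ¬ (c m).IsBlownUp R N ν :=
    fun n m hnm hlt hb => absurd (next_min n m hnm hb) (not_le.mpr hlt)
  let g : ℕ → ℕ := fun j => Nat.rec (next 0) (fun _ gj => next (gj + 1)) j
  have g_zero : g 0 = next 0 := rfl
  have g_succ : ∀ j, g (j + 1) = next (g j + 1) := fun j => rfl
  have g_blown : ∀ j, (c (g j)).IsBlownUp R N ν := by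
    intro j
    cases j with
    | zero => exact (next_spec 0).2
    | succ j => rw [g_succ]; exact (next_spec _).2
  have g_lt : ∀ j, g j < g (j + 1) := fun j => by
    rw [g_succ]; exact Nat.lt_of_lt_of_le (Nat.lt_succ_self _) (next_spec _).1
  have g_mono : StrictMono g := strictMono_nat_of_lt_succ g_lt
  have g_wait : ∀ m, m < g 0 → ¬ (c m).IsBlownUp R N ν := fun m hm => next_wait 0 m (Nat.zero_le m) (by rw [← g_zero]; exact hm)
  have hreach : ∀ n, Reaches R N ν (MarkedStage.init X x) (c n) := reaches_chain h0 hstep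
  have hgen := fun j => exists_genuineStep_of_iso hRf hRa hX hν (hreach (g j)) (hstep (g j)) (g_blown j)
    (hI (g j) (g_blown j))
  choose Cc x' hC hmax hπ hcl hiso using hgen
  have hlink : ∀ j, Nonempty ((blowup (Cc j)).presheaf.stalk (x' j) ≅
      (c (g (j + 1))).W.presheaf.stalk (c (g (j + 1))).pt) := by
    intro j
    obtain ⟨e₁⟩ := hiso j
    obtain ⟨e₂⟩ := nonempty_stalkIso_of_waiting hstep (a := g j + 1) (b := g (j + 1))
      (by rw [g_succ]; exact (next_spec _).1) (fun m hm hlt => next_wait (g j + 1) m hm (by rw [← g_succ]; exact hlt))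
    exact ⟨e₁ ≪≫ e₂⟩
  haveI : ∀ j, IsLocallyNoetherian (c (g j)).W := fun j => (c (g j)).ln
  have hx0 : IsClosed ({(c (g 0)).pt} : Set (c (g 0)).W) := Reaches.isClosed_pt hX.isClosed (hreach (g 0))
  obtain ⟨T, y, hC', hycl, hover, hstalk, htr⟩ :=
    exists_stageTower (W := fun j => (c (g j)).W) (W' := fun j => blowup (Cc j)) (fun j => blowup.π (Cc j)) Cc
      (fun j => blowup.isBlowup (Cc j)) hC (fun j => (c (g j)).pt) hmax x' hπ hcl hlink hx0
  exact ⟨g, T, y, g_mono, g_blown, g_wait, hC', hycl, hover, hstalk, htr⟩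

/-- **THE MOVING-CHAIN SOCKET IN THE HYPERSURFACE CELL** (module docstring). [OURS · L1 W4.2; AI-written]
[cite: CossartJannsenSaito2020, Def. 6.34, Cor. 6.37, Thm. 3.14, Thm. 3.10 (4), p. 107] [cite: CossartPiltant2009, ch. 3 I.9] -/
theorem false_of_e1MovingChain_of_hypersurfaceStage (hF : Theorem314_geomDir.{u})
    (h3104 : CossartJannsenSaito2020_thm_3_10_4.{u}) (h214 : Thm314_point_locus_geomDir.{u})
    (hRf : OracleFunctional R) (hRa : OracleAdmissible R) {p : ℕ} [Fact p.Prime]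
    {X : Scheme.{u}} [IsLocallyNoetherian X] {x : X} (hX : IsMaximalOrigin p 3 ν X x)
    {c : ℕ → MarkedStage.{u}} (h0 : Reaches R 3 ν (MarkedStage.init X x) (c 0))
    (hstep : ∀ n, CanonicalNearStep R 3 ν (c n) (c (n + 1))) (hmov : ∀ n, ∃ m, n ≤ m ∧ (c m).IsBlownUp R 3 ν)
    (hiso : ∀ n, Iso 3 (c n)) (he : Moving.dirDim (c 0) = 1) (hē : (c 0).geomDirDim ≤ 2)
    {Rr : Type u} [CommRing Rr] [IsRegularLocalRing Rr] [CharP Rr p] (hd : (maximalIdeal Rr).spanFinrank = 4)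
    (c4 : Fin 4 → Rr) (hc4 : Ideal.span (Set.range c4) = maximalIdeal Rr)
    (σ : Rr →+* (c 0).W.presheaf.stalk (c 0).pt) (hσ : Function.Surjective σ) {h : Rr}
    (hker : RingHom.ker σ = Ideal.span {h}) {m : ℕ} (hm2 : 2 ≤ m) (hm : h ∈ maximalIdeal Rr ^ m)
    (hm' : h ∉ maximalIdeal Rr ^ (m + 1)) : False := by
  classical
  have hreach : ∀ n, Reaches R 3 ν (MarkedStage.init X x) (c n) := reaches_chain h0 hstep
  -- the regular value is excluded (no marked point is ever blown up there)
  by_cases hν : ν = iterPSum 3 Phi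
  · obtain ⟨n, -, hb⟩ := hmov 0
    exact hX.not_isBlownUp_of_eq_iterPSum hRf hRa hν (hreach n) (hstep n) hb
  -- `ē ≤ 2` and `e ≤ 1` along the chain; `e = 1` at every blown-up stage
  have hG : ∀ n, (c n).geomDirDim ≤ 2 := fun n => (geomDirDim_chain_le h3104 hRa hX hν h0 hstep n).trans hē
  have hE1 : ∀ n, Moving.dirDim (c n) ≤ 1 :=
    dirDim_le_one_of_chain_geomDir hF h3104 h214 projDir_line hRf hRa hX hν h0 hstep he.le hē
  have hEb : ∀ n, (c n).IsBlownUp R 3 ν → Moving.dirDim (c n) = 1 := by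
    intro n hb
    rcases Nat.lt_or_ge (Moving.dirDim (c n)) 1 with hlt | h1
    · exact (false_of_isBlownUp_of_dirDim_eq_zero_geomDir hF hRf hRa hX (hreach n) hb (hstep n) (by omega) (hG n)).elim
    · exact le_antisymm (hE1 n) h1
  -- the stage tower (042), with the waiting prefix
  obtain ⟨g, T, y, -, hgb, hgw, hC, hycl, hover, hstalk, htr⟩ :=
    exists_isoStageTower_of_movingChain' hRf hRa hX hν h0 hstep hmov (fun n _ => hiso n)
  have hO : IsMaximalOrigin p 3 ν (T.X 0) (y 0) := htr (fun Y w => IsMaximalOrigin p 3 ν Y w) (hX.of_reaches hRa (hreach (g 0)))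
  -- `H = ν`, `e = 1`, `ē ≤ 2` at the marked points of the tower (stalk-local)
  have hH : ∀ n, Scheme.hsFun (T.X n) 3 (y n) = ν := by
    intro n
    haveI : IsLocallyNoetherian (T.X n) := T.ln n
    haveI : IsLocallyNoetherian (c (g n)).W := (c (g n)).ln
    obtain ⟨e⟩ := hstalk n
    rw [hsFun_eq_of_stalkIso e 3]
    exact Scheme.mem_hsStratum_iff.mp (pt_mem_hsStratum_of_reaches hX.mem_stratum (hreach (g n)))
  have heT : ∀ n, @Scheme.dirDim (T.X n) (T.ln n) (y n) = 1 := by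
    intro n
    haveI : IsLocallyNoetherian (T.X n) := T.ln n
    haveI : IsLocallyNoetherian (c (g n)).W := (c (g n)).ln
    obtain ⟨e⟩ := hstalk n
    have h1 : Literature.RingTheory.HilbertSamuel.dirDim ((c (g n)).W.presheaf.stalk (c (g n)).pt) = 1 := hEb (g n) (hgb n)
    have h2 := Literature.RingTheory.HilbertSamuel.dirDim_eq_of_ringEquiv e.commRingCatIsoToRingEquiv
    change Literature.RingTheory.HilbertSamuel.dirDim ((T.X n).presheaf.stalk (y n)) = 1
    rw [← h1, ← h2]
  have hGT : ∀ n, @Scheme.geomDirDim (T.X n) (T.ln n) (y n) ≤ 2 := by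
    intro n
    haveI : IsLocallyNoetherian (T.X n) := T.ln n
    haveI : IsLocallyNoetherian (c (g n)).W := (c (g n)).ln
    obtain ⟨e⟩ := hstalk n
    have h1 : Literature.RingTheory.HilbertSamuel.geomDirDim ((c (g n)).W.presheaf.stalk (c (g n)).pt) ≤ 2 := hG (g n)
    change Literature.RingTheory.HilbertSamuel.geomDirDim ((T.X n).presheaf.stalk (y n)) ≤ 2
    rwa [Literature.RingTheory.HilbertSamuel.geomDirDim_eq_of_ringEquiv e.commRingCatIsoToRingEquiv] at h1
  -- structure over the field of the origin, excellence, dimension, permissibility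
  obtain ⟨k, _, _, f₀, hsep, hft, hqc⟩ := hO.exists_structure
  haveI := hsep
  haveI := hft
  haveI := hqc
  obtain ⟨f, -, hf1, hf2⟩ := exists_towerStructure T f₀
  have hexc : ∀ j, Scheme.IsExcellent (T.X j) := fun j =>
    haveI := hf1 j
    Scheme.isExcellent_of_locallyOfFiniteType Stacks07QW_field_holds (f j)
  have hdim : ∀ j, topologicalKrullDim (T.X j) ≤ ((3 : ℕ) : WithBot ℕ∞) := tower_dim_le T hO.dim_le
  have hblow : ∀ j, IsBlowup (T.π j) (vanishingIdeal ⟨{y j}, hycl j⟩) := IsoTailsHS.isBlowup_singleton_of_pointTower hC hycl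
  have hperm' : ∀ j, IdealSheafData.IsPermissible (vanishingIdeal (⟨{y j}, hycl j⟩ : Closeds (T.X j))) := by
    intro j
    haveI : IsLocallyNoetherian (T.X j) := T.ln j
    exact isPermissible_singleton_of_one_le_dirDim (hycl j) (heT j).symm.le
  -- every marked point lies on `ℙ(Dir)` of the previous one: the (F1♯) door at `ē ≤ 2`
  have hon : ∀ n, @IsOnProjDirectrix (T.X (n + 1)) (T.X n) (T.ln n) (T.π n) (y (n + 1)) := by
    intro n
    haveI : IsLocallyNoetherian (T.X n) := T.ln n
    haveI : IsLocallyNoetherian (T.X (n + 1)) := T.ln (n + 1)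
    exact h214 (T.X n) (T.X (n + 1)) (T.π n) (y n) (hycl n) 3 (y (n + 1)) (hexc n) (hperm' n) (hblow n) (hdim n) (hover n)
      (geomDirHypothesis_of_geomDirDim_le_two (hGT n)) (by rw [hH (n + 1), hH n])
  -- isolation at the base of the tower: localise at `x_{g 0}`, cross the link, de-localise at `y_0` (042's three moves)
  have hperm : ∀ j, IdealSheafData.IsPermissible (T.centreIdeal j) := by
    intro j
    haveI : IsLocallyNoetherian (T.X j) := T.ln j
    have hclj : (⟨T.C j, T.isClosed_C j⟩ : Closeds (T.X j)) = ⟨{y j}, hycl j⟩ := Closeds.ext (hC j)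
    show IdealSheafData.IsPermissible (vanishingIdeal ⟨T.C j, T.isClosed_C j⟩)
    rw [hclj]
    exact hperm' j
  have hsup : ∀ j (w : T.X j), ν ≤ Scheme.hsFun (T.X j) 3 w → Scheme.hsFun (T.X j) 3 w = ν :=
    tower_supMax T hexc hperm (fun w hw => le_antisymm (hO.maximal.2 ⟨w, rfl⟩ hw) hw)
  have hI0 : @IsIsolatedInHSMaxLocus (T.X 0) (T.ln 0) 3 (y 0) := by
    haveI : IsLocallyNoetherian (T.X 0) := T.ln 0
    let s := c (g 0)
    haveI : IsLocallyNoetherian s.W := s.ln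
    obtain ⟨k', _, _, hg⟩ := hX.exists_stateGood_of_reaches hRa hν (hreach (g 0))
    obtain ⟨f', hf', -⟩ := hg.overField
    have hsc : ∀ w : s.W, w ⤳ s.pt → Scheme.hsFun s.W 3 w ≤ Scheme.hsFun s.W 3 s.pt :=
      fun w hw => Scheme.hsFun_le_hsFun_of_specializes_over_field f' 3 hw
    let T₀ : BlowupTower.{u} :=
      { X := fun _ => s.W, ln := fun _ => s.ln, C := fun _ => ∅, isClosed_C := fun _ => isClosed_empty,
        π := fun _ => 𝟙 s.W, isBlowup := fun _ => isBlowup_id_vanishingIdeal_empty s.W }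
    have h1 : IsIsolatedInHSMaxLocus (Spec (s.W.presheaf.stalk s.pt)) 3 (closedPoint (s.W.presheaf.stalk s.pt)) :=
      T₀.isIsolatedInHSMaxLocus_localize s.pt 3 hsc (hiso (g 0))
    obtain ⟨e⟩ := hstalk 0
    have h2 : IsIsolatedInHSMaxLocus (Spec ((T.X 0).presheaf.stalk (y 0))) 3 (closedPoint ((T.X 0).presheaf.stalk (y 0))) :=
      isIsolatedInHSMaxLocus_spec_of_iso e.symm 3 h1
    haveI := hf1 0
    haveI := hf2 0
    haveI : IsNoetherian (T.X 0) := Scheme.isNoetherian_of_finiteType_over_field (f 0)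
    have hmaxy : y 0 ∈ Scheme.hsMaxLocus (T.X 0) 3 := by
      rw [Scheme.mem_hsMaxLocus_iff, hH 0]
      exact ⟨⟨y 0, hH 0⟩, fun μ ⟨w, hw⟩ hle => by subst hw; exact (hsup 0 w hle).le⟩
    have hclmax : IsClosed (Scheme.hsMaxLocus (T.X 0) 3) :=
      Scheme.isClosed_hsMaxLocus (fun μ => isClosed_hsStratumGE_over_field (f 0) (hdim 0) μ)
        (Scheme.finite_hsValues_of_isExcellent (hexc 0) 3 (hsPsi_le_of_dim_le' (hdim 0)))
    exact isIsolatedInHSMaxLocus_of_spec 3 (hycl 0) hmaxy hclmax h2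
  -- the hypersurface presentation at the base of the tower: `𝒪_{T.X 0, y 0} ≅ 𝒪_{x_{g 0}} ≅ 𝒪_{x_0}` (waiting prefix)
  haveI : IsLocallyNoetherian (T.X 0) := T.ln 0
  haveI : IsLocallyNoetherian (c 0).W := (c 0).ln
  haveI : IsLocallyNoetherian (c (g 0)).W := (c (g 0)).ln
  obtain ⟨e₀⟩ := hstalk 0
  obtain ⟨e₁⟩ := nonempty_stalkIso_of_waiting hstep (a := 0) (b := g 0) (Nat.zero_le _) (fun m' _ hm' => hgw m' hm')
  let ε : (c 0).W.presheaf.stalk (c 0).pt ≃+* (T.X 0).presheaf.stalk (y 0) := (e₁ ≪≫ e₀.symm).commRingCatIsoToRingEquiv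
  set σ₀ : Rr →+* (T.X 0).presheaf.stalk (y 0) := (ε : _ →+* _).comp σ with hσ₀def
  have hσ₀ : Function.Surjective σ₀ := ε.surjective.comp hσ
  have hker₀ : RingHom.ker σ₀ = Ideal.span {h} := by
    rw [← hker, hσ₀def]
    exact RingHom.ker_equiv_comp σ ε
  exact false_of_e1PointTower_of_hypersurfaceStage hC hover hycl hH hO hI0 heT hon hd c4 hc4 σ₀ hσ₀ hker₀ hm2 hm hm'

end Summit.ResolutionOfSingularities.ResolutionOfSingularities.Theorems.SigmaMaxModificationsCorridor3.E1Free

end
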